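import Summits.AnomalousDissipation.AnomalousDissipation.Theorems.SawtoothPulseCascadeK1LocalisedCascadeDatumSpectrum
import Literature.Analysis.FunctionSpaces.TorusMollifiedFieldFourierBounds
import Literature.Analysis.FunctionSpaces.TorusShearKoopman

/-!
# K1loc, line `Spectral` / thin start — helper: THE PHASE-ONE ITERATE HAS AN EXACT TWO-TERM SPECTRUM (S-D start)

Helper file of the prover lane on the crux `K1LocalisedCascade` (stmt-AnomalousDissipation-19491), route `SawtoothPulseCascade`
(S-B/S-C assembly seat; the START of the amplitude ledger `K1Ledger.From.k1Localised_of_amplitude_ledger`).  The datum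
`sin 2πx₁` has the two modes `±e₀` (`…DatumSpectrum`), so the first two half-steps of the inviscid cascade are EXACT
convolutions with the circle coefficients `ĝ_n(p) = fourierCoeff (twist ψ n) p` of the chirps `g_n = e_{−n} ∘ ψ`
(`Torus.mFourierCoeff_comp_shearMap`), for ANY profile `ψ`:
* §1 `mFourierCoeff_datum_comp_shearMap`: `𝓕(datum ∘ Φ_H)(k) = ĝ_{k₀}(k₁)·𝓕datum(k₀e₀)` — the H-image `b₀` lives on the two
  fibres `k₀ = ±1`, with the chirp spectra `ĝ_{±1}` along them;
* §2 `mFourierCoeff_phaseOne`: `𝓕a₁(k) = (I/2)·(ĝ_{k₁}(k₀+1)·ĝ_{−1}(k₁) − ĝ_{k₁}(k₀−1)·ĝ₁(k₁))` for `a₁ = b₀ ∘ Φ_V`, hence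
  `‖𝓕a₁(k)‖² ≤ ½(‖ĝ_{k₁}(k₀+1)‖²‖ĝ_{−1}(k₁)‖² + ‖ĝ_{k₁}(k₀−1)‖²‖ĝ₁(k₁)‖²)` (`sq_norm_mFourierCoeff_phaseOne_le`);
* §3 Parseval for the chirps (`Σ_p ‖ĝ_n(p)‖² = 1`) and the weighted form
  `Σ' W(k)‖𝓕a₁(k)‖² ≤ ½·Σ'_{(n,p)} W(p,n)·(‖ĝ_n(p+1)‖²‖ĝ_{−1}(n)‖² + ‖ĝ_n(p−1)‖²‖ĝ₁(n)‖²)` for every weight `0 ≤ W ≤ 1`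
  (`tsum_weight_sq_norm_phaseOne_le`): the tracked energy of `a₁` is at most the `ĝ_{±1}`-weighted average over the fibres
  `n = k₁` of the energy of the chirp `g_n` in the (shifted) tracked set — the quantity `…ChirpSidebands` bounds.
No definitions; nothing about the crux. [cite: Grafakos2014, Prop. 3.1.2 (5) and Prop. 3.2.7 (3)] [problem: turb]
-/

-- `Summit.<Summit>.<Problem>`: single-conjunct summit, the duplicate namespace segment is deliberate.
set_option linter.dupNamespace false

noncomputable section

namespace Summit.AnomalousDissipation.AnomalousDissipation.Theorems.SawtoothPulseCascade.K1Start

open MeasureTheory Set Filter Topology UnitAddTorus Function Complex AddCircle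
open Literature.Analysis Literature.Analysis.FunctionSpaces Literature.Analysis.FunctionSpaces.Torus Literature.Analysis.FluidPDE
open Literature.Analysis.FluidPDE.SawtoothCascade

/-! ## §1 The H half-step of the datum -/

/-- The datum has absolutely summable Fourier coefficients (they vanish off `{±e₀}`). [folklore] -/
theorem summable_norm_mFourierCoeff_datum :
    Summable fun k : Fin 2 → ℤ => ‖mFourierCoeff (fun x => (datum x : ℂ)) k‖ := by
  classical
  refine summable_of_ne_finset_zero (s := {Pi.single 0 1, -Pi.single 0 1}) fun k hk => ?_
  rw [Finset.mem_insert, Finset.mem_singleton, not_or] at hk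
  rw [mFourierCoeff_datum, if_neg hk.2, if_neg hk.1]
  simp

/-- The datum's coefficient on the horizontal axis: `𝓕datum(l e₀) = (I/2)([l = −1] − [l = 1])`.
[cite: Grafakos2014, Prop. 3.2.7 (3)] -/
theorem mFourierCoeff_datum_single (l : ℤ) :
    mFourierCoeff (fun x => (datum x : ℂ)) (Pi.single 0 l) =
      I / 2 * ((if l = -1 then (1 : ℂ) else 0) - (if l = 1 then (1 : ℂ) else 0)) := by
  rw [mFourierCoeff_datum]
  have h1 : ((Pi.single (0 : Fin 2) l : Fin 2 → ℤ) = -(Pi.single (0 : Fin 2) (1 : ℤ) : Fin 2 → ℤ)) ↔ l = -1 := by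
    constructor
    · intro h; have h0 := congrFun h 0; simpa using h0
    · rintro rfl; ext i; fin_cases i <;> simp
  have h2 : ((Pi.single (0 : Fin 2) l : Fin 2 → ℤ) = (Pi.single (0 : Fin 2) (1 : ℤ) : Fin 2 → ℤ)) ↔ l = 1 := by
    constructor
    · intro h; have h0 := congrFun h 0; simpa using h0
    · rintro rfl; rfl
  simp only [h1, h2]

/-- **The H half-step of the datum, mode by mode**: for any profile `ψ` and `b₀ = datum ∘ shearMap 0 1 ψ`,
`𝓕b₀(k) = ĝ_{k₀}(k₁) · 𝓕datum(k₀ e₀)` — zero unless `k₀ = ±1`. [cite: Grafakos2014, Prop. 3.1.2 (5)] -/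
theorem mFourierCoeff_datum_comp_shearMap (ψ : ShearProfile) (k : Fin 2 → ℤ) :
    mFourierCoeff (fun x => ((datum ∘ shearMap 0 1 ψ) x : ℂ)) k =
      fourierCoeff (twist ψ (k 0)) (k 1) * mFourierCoeff (fun x => (datum x : ℂ)) (Pi.single 0 (k 0)) := by
  have h01 : (0 : Fin 2) ≠ 1 := by decide
  have hcomp : (fun x => ((datum ∘ shearMap 0 1 ψ) x : ℂ)) = (fun x => (datum x : ℂ)) ∘ shearMap 0 1 ψ := rfl
  rw [hcomp, Torus.mFourierCoeff_comp_shearMap (θ := fun x => (datum x : ℂ)) (continuous_ofReal.comp continuous_datum)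
    summable_norm_mFourierCoeff_datum h01 ψ k, tsum_eq_single (k 1)]
  · congr 2
    ext i; fin_cases i <;> simp
  · intro m hm
    rw [mFourierCoeff_datum]
    have hne1 : k - Pi.single 1 m ≠ -Pi.single 0 1 := by
      intro h; have h1 := congrFun h 1; simp at h1; exact hm (by linarith)
    have hne2 : k - Pi.single 1 m ≠ Pi.single 0 1 := by
      intro h; have h1 := congrFun h 1; simp at h1; exact hm (by linarith)
    rw [if_neg hne1, if_neg hne2]; simp

/-- The H-image of the datum is smooth (the datum `sin 2πx₁` is smooth, and shears are smooth diffeomorphisms). [folklore] -/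
theorem isSmooth_datum_comp_shearMap (ψ : ShearProfile) : IsSmooth (datum ∘ shearMap 0 1 ψ) := by
  have hd : IsSmooth datum := by
    have hper : Function.Periodic (fun s : ℝ => Real.sin (2 * Real.pi * s)) 1 := fun s => by
      simp [mul_add, Real.sin_add_two_pi]
    have h : Torus.lift datum = fun y : EuclideanSpace ℝ (Fin 2) => Real.sin (2 * Real.pi * y 0) := by
      funext y
      exact Torus.lift_coordFun_apply hper 0 y
    unfold Torus.IsSmooth
    rw [h]
    exact Real.contDiff_sin.comp (contDiff_const.mul (contDiff_euclidean.1 contDiff_id 0))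
  exact hd.comp_shearMap 0 1 ψ

/-! ## §2 The V half-step: the phase-one iterate -/

/-- **The phase-one iterate, mode by mode**: for any profile `ψ`, `b₀ = datum ∘ shearMap 0 1 ψ` and `a₁ = b₀ ∘ shearMap 1 0 ψ`,
`𝓕a₁(k) = (I/2)·(ĝ_{k₁}(k₀+1)·ĝ_{−1}(k₁) − ĝ_{k₁}(k₀−1)·ĝ₁(k₁))`. [cite: Grafakos2014, Prop. 3.1.2 (5)] -/
theorem mFourierCoeff_phaseOne (ψ : ShearProfile) {b : UnitAddTorus (Fin 2) → ℝ} (hb : b = datum ∘ shearMap 0 1 ψ)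
    (k : Fin 2 → ℤ) :
    mFourierCoeff (fun x => ((b ∘ shearMap 1 0 ψ) x : ℂ)) k =
      I / 2 * (fourierCoeff (twist ψ (k 1)) (k 0 + 1) * fourierCoeff (twist ψ (-1)) (k 1) -
        fourierCoeff (twist ψ (k 1)) (k 0 - 1) * fourierCoeff (twist ψ 1) (k 1)) := by
  classical
  subst hb
  have h10 : (1 : Fin 2) ≠ 0 := by decide
  have hbs : IsSmooth (datum ∘ shearMap 0 1 ψ) := isSmooth_datum_comp_shearMap ψ
  have hcomp : (fun x => (((datum ∘ shearMap 0 1 ψ) ∘ shearMap 1 0 ψ) x : ℂ)) =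
      (fun x => ((datum ∘ shearMap 0 1 ψ) x : ℂ)) ∘ shearMap 1 0 ψ := rfl
  rw [hcomp, Torus.mFourierCoeff_comp_shearMap (θ := fun x => ((datum ∘ shearMap 0 1 ψ) x : ℂ))
    (continuous_ofReal.comp hbs.continuous) (summable_norm_mFourierCoeff_ofReal_of_isSmooth hbs) h10 ψ k]
  have hterm : ∀ m : ℤ, fourierCoeff (twist ψ (k 1)) m *
      mFourierCoeff (fun x => ((datum ∘ shearMap 0 1 ψ) x : ℂ)) (k - Pi.single 0 m) =
      fourierCoeff (twist ψ (k 1)) m * (fourierCoeff (twist ψ (k 0 - m)) (k 1) *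
        (I / 2 * ((if k 0 - m = -1 then (1 : ℂ) else 0) - (if k 0 - m = 1 then (1 : ℂ) else 0)))) := by
    intro m
    rw [mFourierCoeff_datum_comp_shearMap, mFourierCoeff_datum_single]
    simp
  simp_rw [hterm]
  have hne : k 0 + 1 ≠ k 0 - 1 := by omega
  rw [tsum_eq_sum (s := {k 0 + 1, k 0 - 1})]
  · rw [Finset.sum_pair hne]
    have e1 : k 0 - (k 0 + 1) = -1 := by ring
    have e2 : k 0 - (k 0 - 1) = 1 := by ring
    simp only [e1, e2]
    norm_num
    ring
  · intro m hm
    rw [Finset.mem_insert, Finset.mem_singleton, not_or] at hm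
    have h1 : k 0 - m ≠ -1 := fun h => hm.1 (by linarith)
    have h2 : k 0 - m ≠ 1 := fun h => hm.2 (by linarith)
    rw [if_neg h1, if_neg h2]; simp

/-- **The phase-one energies, mode by mode**:
`‖𝓕a₁(k)‖² ≤ ½(‖ĝ_{k₁}(k₀+1)‖²·‖ĝ_{−1}(k₁)‖² + ‖ĝ_{k₁}(k₀−1)‖²·‖ĝ₁(k₁)‖²)` (`|I/2| = ½`, `(u+v)² ≤ 2(u²+v²)`).
[cite: Grafakos2014, Prop. 3.1.2 (5)] -/
theorem sq_norm_mFourierCoeff_phaseOne_le (ψ : ShearProfile) {b : UnitAddTorus (Fin 2) → ℝ}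
    (hb : b = datum ∘ shearMap 0 1 ψ) (k : Fin 2 → ℤ) :
    ‖mFourierCoeff (fun x => ((b ∘ shearMap 1 0 ψ) x : ℂ)) k‖ ^ 2 ≤
      1 / 2 * (‖fourierCoeff (twist ψ (k 1)) (k 0 + 1)‖ ^ 2 * ‖fourierCoeff (twist ψ (-1)) (k 1)‖ ^ 2 +
        ‖fourierCoeff (twist ψ (k 1)) (k 0 - 1)‖ ^ 2 * ‖fourierCoeff (twist ψ 1) (k 1)‖ ^ 2) := by
  rw [mFourierCoeff_phaseOne ψ hb k, norm_mul]
  set u := ‖fourierCoeff (twist ψ (k 1)) (k 0 + 1)‖ * ‖fourierCoeff (twist ψ (-1)) (k 1)‖ with hu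
  set v := ‖fourierCoeff (twist ψ (k 1)) (k 0 - 1)‖ * ‖fourierCoeff (twist ψ 1) (k 1)‖ with hv
  have hI : ‖(I / 2 : ℂ)‖ = 1 / 2 := by simp
  have hdiff : ‖fourierCoeff (twist ψ (k 1)) (k 0 + 1) * fourierCoeff (twist ψ (-1)) (k 1) -
      fourierCoeff (twist ψ (k 1)) (k 0 - 1) * fourierCoeff (twist ψ 1) (k 1)‖ ≤ u + v := by
    refine (norm_sub_le _ _).trans ?_
    rw [norm_mul, norm_mul]
  have hu0 : 0 ≤ u := by positivity
  have hv0 : 0 ≤ v := by positivity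
  rw [hI]
  calc (1 / 2 * ‖fourierCoeff (twist ψ (k 1)) (k 0 + 1) * fourierCoeff (twist ψ (-1)) (k 1) -
        fourierCoeff (twist ψ (k 1)) (k 0 - 1) * fourierCoeff (twist ψ 1) (k 1)‖) ^ 2
      ≤ (1 / 2 * (u + v)) ^ 2 := by gcongr
    _ ≤ 1 / 2 * (u ^ 2 + v ^ 2) := by nlinarith [sq_nonneg (u - v)]
    _ = _ := by rw [hu, hv, mul_pow, mul_pow]

/-! ## §3 Parseval for the chirps and the weighted form -/

/-- **Parseval for a chirp**: `Σ_p ‖ĝ_n(p)‖² = 1` for `g_n = e_{−n} ∘ ψ` (`|g_n| = 1` on a probability space).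
[cite: Grafakos2014, Prop. 3.2.7 (3)] -/
theorem hasSum_sq_norm_fourierCoeff_twist (ψ : ShearProfile) (n : ℤ) :
    HasSum (fun p : ℤ => ‖fourierCoeff (twist ψ n) p‖ ^ 2) 1 := by
  have hc : Continuous (twist ψ n) := continuous_twist ψ n
  have hmem : MemLp (twist ψ n) 2 haarAddCircle :=
    (memLp_top_of_bound hc.aestronglyMeasurable 1 (Eventually.of_forall fun b => (norm_twist ψ n b).le)).mono_exponent
      le_top
  have h := hasSum_sq_fourierCoeff (hmem.toLp _)
  have hcoe : ∀ p, fourierCoeff (hmem.toLp _) p = fourierCoeff (twist ψ n) p := by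
    intro p
    simp only [fourierCoeff]
    exact integral_congr_ae (by filter_upwards [MemLp.coeFn_toLp hmem] with x hx; simp only [hx])
  have hint : ∫ t, ‖(hmem.toLp _) t‖ ^ 2 ∂haarAddCircle = 1 := by
    have h1 : ∫ t, ‖(hmem.toLp _) t‖ ^ 2 ∂haarAddCircle = ∫ t, ‖twist ψ n t‖ ^ 2 ∂haarAddCircle :=
      integral_congr_ae (by filter_upwards [MemLp.coeFn_toLp hmem] with t ht; rw [ht])
    rw [h1]
    simp [norm_twist]
  simp_rw [hcoe] at h
  rwa [hint] at h

/-- `Σ' p, ‖ĝ_n(p)‖² = 1`. [cite: Grafakos2014, Prop. 3.2.7 (3)] -/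
theorem tsum_sq_norm_fourierCoeff_twist (ψ : ShearProfile) (n : ℤ) :
    ∑' p : ℤ, ‖fourierCoeff (twist ψ n) p‖ ^ 2 = 1 :=
  (hasSum_sq_norm_fourierCoeff_twist ψ n).tsum_eq

/-- Shifted Parseval: `Σ' p, ‖ĝ_n(p + c)‖² = 1`. [cite: Grafakos2014, Prop. 3.2.7 (3)] -/
theorem tsum_sq_norm_fourierCoeff_twist_shift (ψ : ShearProfile) (n c : ℤ) :
    ∑' p : ℤ, ‖fourierCoeff (twist ψ n) (p + c)‖ ^ 2 = 1 := by
  exact ((Equiv.addRight c).tsum_eq (fun p => ‖fourierCoeff (twist ψ n) p‖ ^ 2)).trans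
    (tsum_sq_norm_fourierCoeff_twist ψ n)

/-- Shifted Parseval, summability. [folklore] -/
theorem summable_sq_norm_fourierCoeff_twist_shift (ψ : ShearProfile) (n c : ℤ) :
    Summable fun p : ℤ => ‖fourierCoeff (twist ψ n) (p + c)‖ ^ 2 :=
  (Equiv.addRight c).summable_iff.2 (hasSum_sq_norm_fourierCoeff_twist ψ n).summable

/-- **Product families with normalised fibres**: if `u ≥ 0` has sum `S` and every `v n ≥ 0` has sum `1`, then
`(n,p) ↦ v n p · u n` has sum `S` on `ℤ × ℤ`. [folklore] -/
theorem hasSum_prod_of_fibre_one {u : ℤ → ℝ} {S : ℝ} (hu : HasSum u S) (hu0 : ∀ n, 0 ≤ u n) {v : ℤ → ℤ → ℝ}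
    (hv : ∀ n, HasSum (v n) 1) (hv0 : ∀ n p, 0 ≤ v n p) :
    HasSum (fun q : ℤ × ℤ => v q.1 q.2 * u q.1) S := by
  have hfib : ∀ n, HasSum (fun p => v n p * u n) (u n) := fun n => by
    simpa using (hv n).mul_right (u n)
  have hs : Summable fun q : ℤ × ℤ => v q.1 q.2 * u q.1 := by
    refine (summable_prod_of_nonneg fun q => mul_nonneg (hv0 _ _) (hu0 _)).2 ⟨fun n => (hfib n).summable, ?_⟩
    simp_rw [fun n => (hfib n).tsum_eq]
    exact hu.summable
  have h := hs.hasSum.prod_fiberwise hfib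
  exact (h.unique hu) ▸ hs.hasSum

/-- **The phase-one majorant is summable on `ℤ × ℤ`** (indexed by `(n, p) = (k₁, k₀)`): the family
`(n,p) ↦ ‖ĝ_n(p+1)‖²‖ĝ_{−1}(n)‖² + ‖ĝ_n(p−1)‖²‖ĝ₁(n)‖²` has sum `2` (Parseval twice). [cite: Grafakos2014, Prop. 3.2.7 (3)] -/
theorem hasSum_phaseOne_majorant (ψ : ShearProfile) :
    HasSum (fun q : ℤ × ℤ => ‖fourierCoeff (twist ψ q.1) (q.2 + 1)‖ ^ 2 * ‖fourierCoeff (twist ψ (-1)) q.1‖ ^ 2 +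
      ‖fourierCoeff (twist ψ q.1) (q.2 - 1)‖ ^ 2 * ‖fourierCoeff (twist ψ 1) q.1‖ ^ 2) 2 := by
  have hA : HasSum (fun q : ℤ × ℤ => ‖fourierCoeff (twist ψ q.1) (q.2 + 1)‖ ^ 2 *
      ‖fourierCoeff (twist ψ (-1)) q.1‖ ^ 2) 1 :=
    hasSum_prod_of_fibre_one (hasSum_sq_norm_fourierCoeff_twist ψ (-1)) (fun n => sq_nonneg _)
      (v := fun n p => ‖fourierCoeff (twist ψ n) (p + 1)‖ ^ 2)
      (fun n => (Equiv.addRight (1 : ℤ)).hasSum_iff.2 (hasSum_sq_norm_fourierCoeff_twist ψ n))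
      (fun n p => sq_nonneg _)
  have hB : HasSum (fun q : ℤ × ℤ => ‖fourierCoeff (twist ψ q.1) (q.2 - 1)‖ ^ 2 *
      ‖fourierCoeff (twist ψ 1) q.1‖ ^ 2) 1 :=
    hasSum_prod_of_fibre_one (hasSum_sq_norm_fourierCoeff_twist ψ 1) (fun n => sq_nonneg _)
      (v := fun n p => ‖fourierCoeff (twist ψ n) (p - 1)‖ ^ 2)
      (fun n => by
        have h := (Equiv.addRight (-1 : ℤ)).hasSum_iff.2 (hasSum_sq_norm_fourierCoeff_twist ψ n)
        exact h.congr_fun fun p => by simp [sub_eq_add_neg])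
      (fun n p => sq_nonneg _)
  have h := hA.add hB
  norm_num at h
  exact h

/-- **The weighted phase-one bound on `ℤ × ℤ`**: for `b₀ = datum ∘ Φ_H`, `a₁ = b₀ ∘ Φ_V` (profile `ψ`) and any weight
`0 ≤ W ≤ 1` on the frequency lattice, `Σ' k, W(k)‖𝓕a₁(k)‖² ≤ ½·Σ'_{(n,p)} W(p,n)·(‖ĝ_n(p+1)‖²‖ĝ_{−1}(n)‖² + ‖ĝ_n(p−1)‖²‖ĝ₁(n)‖²)`,
with `(p, n) = (k₀, k₁)`.  The right-hand side is summable (`hasSum_phaseOne_majorant`), so it can be bounded fibre by fibre.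
[cite: Grafakos2014, Prop. 3.1.2 (5) and Prop. 3.2.7 (3)] -/
theorem tsum_weight_sq_norm_phaseOne_le (ψ : ShearProfile) {b a : UnitAddTorus (Fin 2) → ℝ}
    (hb : b = datum ∘ shearMap 0 1 ψ) (ha : a = b ∘ shearMap 1 0 ψ) {W : (Fin 2 → ℤ) → ℝ} (hW0 : ∀ k, 0 ≤ W k)
    (hW1 : ∀ k, W k ≤ 1) :
    ∑' k : Fin 2 → ℤ, W k * ‖mFourierCoeff (fun x => (a x : ℂ)) k‖ ^ 2 ≤
      1 / 2 * ∑' q : ℤ × ℤ, W (![q.2, q.1]) *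
        (‖fourierCoeff (twist ψ q.1) (q.2 + 1)‖ ^ 2 * ‖fourierCoeff (twist ψ (-1)) q.1‖ ^ 2 +
          ‖fourierCoeff (twist ψ q.1) (q.2 - 1)‖ ^ 2 * ‖fourierCoeff (twist ψ 1) q.1‖ ^ 2) := by
  classical
  subst ha
  -- the lattice `Fin 2 → ℤ` as `ℤ × ℤ` through `k ↦ (k 1, k 0)`
  set e : (Fin 2 → ℤ) ≃ ℤ × ℤ := (piFinTwoEquiv fun _ => ℤ).trans (Equiv.prodComm ℤ ℤ) with he
  have he' : ∀ q : ℤ × ℤ, e.symm q = ![q.2, q.1] := by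
    intro q; ext i; fin_cases i <;> simp [he, piFinTwoEquiv]
  set M : ℤ × ℤ → ℝ := fun q => ‖fourierCoeff (twist ψ q.1) (q.2 + 1)‖ ^ 2 * ‖fourierCoeff (twist ψ (-1)) q.1‖ ^ 2 +
    ‖fourierCoeff (twist ψ q.1) (q.2 - 1)‖ ^ 2 * ‖fourierCoeff (twist ψ 1) q.1‖ ^ 2 with hM
  have hMs : Summable M := (hasSum_phaseOne_majorant ψ).summable
  have hM0 : ∀ q, 0 ≤ M q := fun q => by positivity
  -- termwise bound, transported to `ℤ × ℤ`
  have hpt : ∀ k : Fin 2 → ℤ, W k * ‖mFourierCoeff (fun x => ((b ∘ shearMap 1 0 ψ) x : ℂ)) k‖ ^ 2 ≤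
      1 / 2 * (W (e.symm (e k)) * M (e k)) := by
    intro k
    rw [Equiv.symm_apply_apply]
    have h := sq_norm_mFourierCoeff_phaseOne_le ψ hb k
    have hMk : M (e k) = ‖fourierCoeff (twist ψ (k 1)) (k 0 + 1)‖ ^ 2 * ‖fourierCoeff (twist ψ (-1)) (k 1)‖ ^ 2 +
        ‖fourierCoeff (twist ψ (k 1)) (k 0 - 1)‖ ^ 2 * ‖fourierCoeff (twist ψ 1) (k 1)‖ ^ 2 := by
      simp [hM, he, piFinTwoEquiv]
    rw [hMk]
    nlinarith [hW0 k, hW1 k]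
  have hWMs : Summable fun q : ℤ × ℤ => W (e.symm q) * M q :=
    Summable.of_nonneg_of_le (fun q => mul_nonneg (hW0 _) (hM0 q))
      (fun q => mul_le_of_le_one_left (hM0 q) (hW1 _)) hMs
  have hs1 : Summable fun k : Fin 2 → ℤ => 1 / 2 * (W (e.symm (e k)) * M (e k)) :=
    ((e.summable_iff.2 hWMs).mul_left (1 / 2))
  have hs0 : Summable fun k : Fin 2 → ℤ => W k * ‖mFourierCoeff (fun x => ((b ∘ shearMap 1 0 ψ) x : ℂ)) k‖ ^ 2 :=
    Summable.of_nonneg_of_le (fun k => mul_nonneg (hW0 k) (sq_nonneg _)) hpt hs1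
  calc ∑' k : Fin 2 → ℤ, W k * ‖mFourierCoeff (fun x => ((b ∘ shearMap 1 0 ψ) x : ℂ)) k‖ ^ 2
      ≤ ∑' k : Fin 2 → ℤ, 1 / 2 * (W (e.symm (e k)) * M (e k)) := Summable.tsum_le_tsum hpt hs0 hs1
    _ = 1 / 2 * ∑' k : Fin 2 → ℤ, W (e.symm (e k)) * M (e k) := tsum_mul_left
    _ = 1 / 2 * ∑' q : ℤ × ℤ, W (e.symm q) * M q := by
        rw [e.tsum_eq (fun q => W (e.symm q) * M q)]
    _ = _ := by simp_rw [he']; rfl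

end Summit.AnomalousDissipation.AnomalousDissipation.Theorems.SawtoothPulseCascade.K1Start
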